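import Literature.AlgebraicGeometry.Frobenioids.Prop53SubRlfIsFrobenioid
import Literature.AlgebraicGeometry.Frobenioids.ArithmeticFrobenioidIsotropic
import HarnessLib

/-!
# Frobenioids I, Prop. 5.3 / Thm. 5.2: the standing hypotheses of Thm. 5.2 for the data `(Φ, Φ^birat)` of a
# pre-Frobenioid over a base of FSM-type — the `h` binder of the `C^un-tr` / `(C^un-tr)^pf` model rows DISCHARGED

Mochizuki, *The geometry of Frobenioids I: the general theory*, Kyushu J. Math. **62** (2008) 293–400, Thm. 5.2
p. 100 (standing hypotheses: "`Φ` a divisorial monoid on a connected, totally epimorphic category `D`", "`B` a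
group-like monoid on `D`") and Prop. 5.3 p. 103 l. 16–19 ("the Frobenioid `C^un-tr` (respectively, `(C^un-tr)^pf`) …
may be obtained as the model Frobenioid associated to the divisor monoid `Φ` (respectively, `Φ^pf`) … and the rational
function monoid `Φ^birat`") [cite: MochizukiFrdI2008, Prop. 5.3 p.103].

PROOF-ONLY (cell abc-iut, L1 sub-DAG W3 = [FrdI] Prop. 5.3 + Cor. 5.4, seat abc-iut-w5-d137).  Row P53/L04
(`PreFrobenioid.exists_untrPf_comparison_overBase`, seat abc-iut-L1-d5) and the `C^un-tr` model rows carry the binder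
`h : ModelFrobenioid.Hypotheses Φ (biratSubfunctor F).toMonoid` — the hypotheses of Thm. 5.2 for `(Φ, Φ^birat)`, whose
only non-automatic clause is "`Φ^birat` is a monoid on `D`" (pull-backs surjective along FSM-morphisms, row P53/L02d).
Here:
* `GpSubfunctor.isMonoidOn_toMonoid` — generic: for an integral monoid `Φ` on `D`, ANY subfunctor of groups
  `Ψ ⊆ Φ^gp` with FSM-surjective pull-backs is a monoid on `D` (injectivity inherited from `Φ^gp`, Def. 1.1 (ii);
  characteristic injectivity is vacuous for a group);
* `GpSubfunctor.toMonoid_isGroupLike` — `Ψ` is (objectwise) group-like;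
* `PreFrobenioid.untrModel_hypotheses` — `ModelFrobenioid.Hypotheses Φ (biratSubfunctor F).toMonoid` from a
  pre-Frobenioid structure `F : C → F_Φ` (which CARRIES "`Φ` divisorial monoid on `D`, `D` connected, totally
  epimorphic", Def. 1.1 (iv)) and the one input `BiratFSMSurjective F`; `untrModel_hypotheses_of_isOfFSMType` — over a
  base of FSM-type NO input is left (row L02d is automatic there, `biratFSMSurjective_of_isOfFSMType`);
* `arithFrobenioid_untrModel_hypotheses` — the instance at THE arithmetic Frobenioid `C_{K/F}` of Ex. 6.3.
No definitions, no new `Prop`; nothing here bears on [IUTchIII] Cor. 3.12 (L1 = [FrdI], a refereed preparatory paper).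
-/

noncomputable section

namespace Literature.AlgebraicGeometry.Frobenioids

open CategoryTheory Opposite Function Literature.AnabelianGeometry.EtaleTheta

universe w v v' u u'

/-! ### A subfunctor of groups of `Φ^gp` is a group-like monoid on `D` -/

namespace GpSubfunctor

variable {D : Type u} [Category.{v} D] {Φ : Dᵒᵖ ⥤ CommMonCat.{w}} (Ψ : GpSubfunctor Φ)

/-- **Def. 1.1 (ii) for a subfunctor of groups**: if `Φ` is an integral monoid on `D` and the pull-backs of
`Ψ ⊆ Φ^gp` are surjective along FSM-morphisms, then `Ψ` (`Ψ.toMonoid`) is a monoid on `D` — its pull-backs are the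
restrictions of those of `Φ^gp`, injective because `Φ(f)^gp` is (`Φ(f)` injective, `Φ(X)` cancellative), with trivial
monoids of associates (a group). [cite: MochizukiFrdI2008, Def. 1.1 (ii) p.19] -/
theorem isMonoidOn_toMonoid (hΦ : IsMonoidOn Φ) (hint : Objectwise (fun M _ => IsIntegral M) Φ)
    (hΨ : Ψ.IsFSMSurjective) : IsMonoidOn Ψ.toMonoid := by
  have hinj : ∀ {A B : D} (α : B ⟶ A), Injective (pull Ψ.toMonoid α) := by
    intro A B α a b hab
    haveI : IsCancelMul (Φ.obj (op A)) := isIntegral_iff_isCancelMul.mp (hint A)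
    haveI : IsCancelMul (Φ.obj (op B)) := isIntegral_iff_isCancelMul.mp (hint B)
    have hg : Injective (pullGp Φ α) := gpMap_injective (pull Φ α) (hΦ.isCharInjective α).1
    exact Subtype.ext (hg (congrArg Subtype.val hab))
  refine ⟨fun {A B} α => ⟨hinj α, ?_⟩, fun {A B} α hα => ⟨hinj α, ?_⟩⟩
  · haveI : Subsingleton (Associates (Ψ.toMonoid.obj (op A))) :=
      associates_subsingleton_of_group (G := Ψ.carrier A)
    exact fun x y _ => Subsingleton.elim x y
  · rintro ⟨y, hy⟩
    obtain ⟨x, hx, hxy⟩ := hΨ α hα y hy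
    exact ⟨⟨x, hx⟩, Subtype.ext hxy⟩

/-- `Ψ(X) ⊆ Φ(X)^gp` is a group, hence a group-like monoid (Thm. 5.2 p. 100, "`B` a group-like monoid").
[cite: MochizukiFrdI2008, Thm. 5.2 p.100] -/
theorem toMonoid_isGroupLike : Objectwise (fun M _ => IsGroupLike M) Ψ.toMonoid :=
  fun X => isGroupLike_of_commGroup (Ψ.carrier X)

end GpSubfunctor

/-! ### The hypotheses of Thm. 5.2 for `(Φ, Φ^birat)` -/

namespace PreFrobenioid

variable {D : Type u} [Category.{v} D] {Φ : Dᵒᵖ ⥤ CommMonCat.{w}}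
  {C : Type u'} [Category.{v'} C] (F : C ⥤ ElemFrobenioid Φ)

/-- **The standing hypotheses of Thm. 5.2 for the data `(Φ, Φ^birat)` of a pre-Frobenioid** (the `h` binder of the
`C^un-tr` / `(C^un-tr)^pf` model rows of Prop. 5.3): `Φ` is a divisorial monoid on the connected, totally epimorphic `D`
(Def. 1.1 (iv), carried by `IsPreFrobenioid`), and `Φ^birat` is a group-like monoid on `D` granted the FSM-surjectivity
of its pull-backs (row P53/L02d, `FrdI.Prop53Sub.BiratFSMSurjective F`). [cite: MochizukiFrdI2008, Prop. 5.3 p.103] -/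
theorem untrModel_hypotheses (hP : IsPreFrobenioid Φ F) (h02d : FrdI.Prop53Sub.BiratFSMSurjective F) :
    ModelFrobenioid.Hypotheses Φ (biratSubfunctor F).toMonoid where
  isMonoidOn := hP.isMonoidOn
  isDivisorial := hP.isDivisorial
  isMonoidOn_rat := (biratSubfunctor F).isMonoidOn_toMonoid hP.isMonoidOn
    (fun X => (hP.isDivisorial X).isPreDivisorial.isIntegral) h02d
  isGroupLike_rat := (biratSubfunctor F).toMonoid_isGroupLike
  isGraphConnected := hP.isGraphConnected_base
  isTotallyEpimorphic := hP.isTotallyEpimorphic_base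

/-- **Over a base of FSM-type no input is left**: the hypotheses of Thm. 5.2 for `(Φ, Φ^birat)` hold for EVERY
pre-Frobenioid `F : C → F_Φ` over a base category of FSM-type (every FSM-morphism an isomorphism — every base of §6
and of [IUTchI]). [cite: MochizukiFrdI2008, Prop. 5.3 p.103] -/
theorem untrModel_hypotheses_of_isOfFSMType (hP : IsPreFrobenioid Φ F) (hD : IsOfFSMType D) :
    ModelFrobenioid.Hypotheses Φ (biratSubfunctor F).toMonoid :=
  untrModel_hypotheses F hP (FrdI.Prop53Sub.biratFSMSurjective_of_isOfFSMType F hD)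

end PreFrobenioid

/-! ### Instance: THE arithmetic Frobenioid `C_{K/F}` (Ex. 6.3) -/

section Arith

variable (F : Type) [Field F] [NumberField F] (K : Type) [Field K] [Algebra F K] [IsGalois F K]

/-- **The hypotheses of Thm. 5.2 for `(Φ, Φ^birat)` of THE arithmetic Frobenioid `C_{K/F}`** (`K/F` a Galois
extension of number fields; Ex. 6.3 p. 113: "`Φ`, `B` determine monoids on `D`"), for any pre-Frobenioid witness
(`C_{K/F}` IS a Frobenioid, seat abc-iut-L6-t10's `arithFrobenioid_isFrobenioid`, so the witness is available BY NAME).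
[cite: MochizukiFrdI2008, Ex. 6.3 p.113] -/
theorem arithFrobenioid_untrModel_hypotheses
    (hP : IsPreFrobenioid (arithDivisorFunctor F K)
      (ModelFrobenioid.toElem (arithDivisorFunctor F K) (unitsFunctor F K) (divNatTrans F K))) :
    ModelFrobenioid.Hypotheses (arithDivisorFunctor F K)
      (PreFrobenioid.biratSubfunctor
        (ModelFrobenioid.toElem (arithDivisorFunctor F K) (unitsFunctor F K) (divNatTrans F K))).toMonoid :=
  PreFrobenioid.untrModel_hypotheses_of_isOfFSMType _ hP (FinSubextCat.isOfFSMType F K)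

end Arith

end Literature.AlgebraicGeometry.Frobenioids

end
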